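import Mathlib
import Summits.MatrixMultiplication.MatrixMultiplication.Theorems.SubgroupIdentityDesigns.Negative.TorusBudget
import Summits.MatrixMultiplication.MatrixMultiplication.Theorems.SubgroupIdentityDesigns.Negative.ProjectiveLine
import Summits.MatrixMultiplication.MatrixMultiplication.Theorems.SubgroupIdentityDesigns.Negative.BorelConjugation

/-!
# The one-`p`-member volume law (all `p`): `U⁺ ≤ H₁ ≤ B⁺` closes the triple

Route `LevelGradedCohnUmans`, crux `SubgroupIdentityDesigns`, the `(m,k) = (2,1)` cell.

Let `(H₁, H₂, H₃)` be a subgroup-TPP triple of `GL₂(𝔽_p)` with `U⁺ ≤ H₁` and a diagonal subgroup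
`D₁ ≤ H₁` (a frame member `H₁ = U⁺T₁` has `|H₁| = p|D₁|`); `H₂, H₃` are ARBITRARY.  If the triple
carries a level-`1` identity design then (`volume_law_onePMember`)
`|D₁|·|H₂|·|H₃| ≤ (p-1)(p+1)²`, hence for a frame member `|H₁||H₂||H₃| ≤ p(p+1)²(p-1)`, which is
below the level-one floor for `p ≥ 5`: NO level-one witness of the crux inequality for any
`0 < ε ≤ 1` (`no_levelOne_witness_onePMember`).  If moreover `H₃` has a diagonal subgroup `D₃` with
`|H₃| ≤ p|D₃|` (the placement `(U⁺T₁, S, U⁻T₂)` of the two-`p`-member case) the bound sharpens to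
`|H₁||H₂||H₃| ≤ p²(p²-1)`, below the floor for every `p ≥ 3` (`no_levelOne_witness_of_frame13`).

Proof: `S' = H₂ ∩ B⁺` has no unitriangular element but `1` (TPP with `U⁺ ≤ H₁`), so a unitriangular
`u ∈ U⁺ ≤ H₁` conjugates it to a diagonal group (`BorelConjugation.exists_unitri_conj_diag`);
conjugating the whole triple by `u` keeps TPP and the design (`KernelLaw.idTest_map_conj`), and the
torus budget (`TorusBudget.torus_budget`) gives `|D₁|·|S'|·|(uH₃u⁻¹) ∩ B⁺| ≤ p - 1`; the
projective-line bound (`ProjectiveLine.card_le_succ_mul_card_upper`) turns the two Borel parts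
back into `|H₂|/(p+1)` and `|H₃|/(p+1)`.

Together with `TwoPMemberLaw` this closes, for all `p ≥ 5`, every TPP triple one of whose END
members contains `U⁺` inside its Borel; what remains of the `(2,1)` cell is the placement with the
only `p`-member in the MIDDLE, the `p`-free triples, non-Borel `p`-members and `p = 3`.

VALUE = THEOREM (all `p`), NOT summit progress; the crux item stmt-MatrixMultiplication-14079 is
untouched and remains open.
-/

set_option linter.dupNamespace false

noncomputable section

open scoped BigOperators Classical

open Summit.MatrixMultiplication.MatrixMultiplication.Theorems.LieRankDesigns.Negative
  (GLm Mat fourierFn budget)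
open Summit.MatrixMultiplication.MatrixMultiplication.Theorems.LevelOneGL2Designs.Negative
  (levelSubmodule fourierFn_mem_levelSubmodule)

namespace Summit.MatrixMultiplication.MatrixMultiplication.Theorems.SubgroupIdentityDesigns.Negative

section OnePMemberLaw

open Literature.Barriers.MatrixMultiplication (SubgroupTPP)

variable {p : ℕ} [hp : Fact p.Prime]

omit hp in
/-- Membership in a `u`-conjugate subgroup. -/
theorem mem_map_conj_iff' {H : Subgroup (GLm p 2)} {u x : GLm p 2} :
    x ∈ H.map (MulAut.conj u).toMonoidHom ↔ u⁻¹ * x * u ∈ H := by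
  have h := @mem_map_conj_inv_iff _ _ H u⁻¹ x
  simpa using h

omit hp in
/-- Conjugation preserves the cardinality of a subgroup. -/
theorem card_map_conj_eq (H : Subgroup (GLm p 2)) (u : GLm p 2) :
    Nat.card (H.map (MulAut.conj u).toMonoidHom) = Nat.card H :=
  (Nat.card_congr (Subgroup.equivMapOfInjective H _ (MulAut.conj u).injective).toEquiv).symm

/-- **Torus budget after Borel conjugation.**  TPP + `U⁺ ≤ H₁` + a diagonal `D₁ ≤ H₁` + a
level-`1` identity design: there is `u ∈ H₁` (unitriangular) such that, with `S' = H₂ ∩ B⁺` and any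
upper-triangular subgroup `S₃ ≤ uH₃u⁻¹`, `|D₁|·|S'|·|S₃| ≤ p - 1`; packaged here with the index
bound as `|D₁|·|H₂|·|S₃| ≤ (p-1)(p+1)`. -/
theorem conj_torus_budget {H₁ H₂ H₃ : Subgroup (GLm p 2)} (htpp : SubgroupTPP H₁ H₂ H₃)
    (hU : ∀ u : GLm p 2, (u : Mat p 2) 1 0 = 0 → (u : Mat p 2) 0 0 = 1 → (u : Mat p 2) 1 1 = 1 →
      u ∈ H₁)
    {D₁ : Subgroup (GLm p 2)} (hD₁ : D₁ ≤ H₁)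
    (hd₁ : ∀ d ∈ D₁, (d : Mat p 2) 0 1 = 0 ∧ (d : Mat p 2) 1 0 = 0)
    (hdesign : ∃ f ∈ levelSubmodule p 2 1, f 1 = 1 ∧
      ∀ a ∈ H₁, ∀ b ∈ H₂, ∀ c ∈ H₃, a * b * c ≠ 1 → f (a * b * c) = 0) :
    ∃ (t : ZMod p) (u : GLm p 2), (u : Mat p 2) = !![1, t; 0, 1] ∧
      ((u⁻¹ : GLm p 2) : Mat p 2) = !![1, -t; 0, 1] ∧
      ∀ S₃ : Subgroup (GLm p 2), S₃ ≤ H₃.map (MulAut.conj u).toMonoidHom →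
        (∀ s ∈ S₃, (s : Mat p 2) 1 0 = 0) →
        Nat.card D₁ * Nat.card H₂ * Nat.card S₃ ≤ (p - 1) * (p + 1) := by
  obtain ⟨S', hS'le, hs', hS'B⟩ := exists_upper_part H₂
  have hE1 : ∀ v ∈ S', (v : Mat p 2) 1 0 = 0 → (v : Mat p 2) 0 0 = 1 → (v : Mat p 2) 1 1 = 1 →
      v = 1 := fun v hv h10 h00 h11 =>
    (htpp v⁻¹ (H₁.inv_mem (hU v h10 h00 h11)) v (hS'le hv) 1 H₃.one_mem (by group)).2.1
  obtain ⟨t, u, hu, hu', hdiag⟩ := exists_unitri_conj_diag S' hs' hE1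
  have huH : u ∈ H₁ := hU u (by simp [hu]) (by simp [hu]) (by simp [hu])
  refine ⟨t, u, hu, hu', fun S₃ hS₃ hs₃ => ?_⟩
  have htpp' : SubgroupTPP (H₁.map (MulAut.conj u).toMonoidHom)
      (H₂.map (MulAut.conj u).toMonoidHom) (H₃.map (MulAut.conj u).toMonoidHom) :=
    subgroupTPP_map_of_injective _ (MulAut.conj u).injective htpp
  have hdes' : ∃ f ∈ levelSubmodule p 2 1, f 1 = 1 ∧
      ∀ a ∈ H₁.map (MulAut.conj u).toMonoidHom, ∀ b ∈ H₂.map (MulAut.conj u).toMonoidHom,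
        ∀ c ∈ H₃.map (MulAut.conj u).toMonoidHom, a * b * c ≠ 1 → f (a * b * c) = 0 := by
    simpa using idTest_map_conj u⁻¹ hdesign
  have hU' : ∀ x : GLm p 2, (x : Mat p 2) 1 0 = 0 → (x : Mat p 2) 0 0 = 1 → (x : Mat p 2) 1 1 = 1 →
      x ∈ H₁.map (MulAut.conj u).toMonoidHom := fun x h10 h00 h11 =>
    mem_map_conj_iff'.mpr (H₁.mul_mem (H₁.mul_mem (H₁.inv_mem huH) (hU x h10 h00 h11)) huH)
  have hD₁' : D₁ ≤ H₁.map (MulAut.conj u).toMonoidHom := fun d hd =>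
    mem_map_conj_iff'.mpr (H₁.mul_mem (H₁.mul_mem (H₁.inv_mem huH) (hD₁ hd)) huH)
  have hd₂' : ∀ x ∈ S'.map (MulAut.conj u).toMonoidHom,
      (x : Mat p 2) 0 1 = 0 ∧ (x : Mat p 2) 1 0 = 0 := by
    intro x hx
    have h := hdiag _ (mem_map_conj_iff'.mp hx)
    rwa [show u * (u⁻¹ * x * u) * u⁻¹ = x by group] at h
  have h1 := torus_budget htpp' hU' hD₁' (Subgroup.map_mono hS'le) hS₃ hd₁ hd₂' hs₃ hdes'
  rw [card_map_conj_eq] at h1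
  have h2 := card_le_succ_mul_card_upper H₂ S' hS'B
  calc Nat.card D₁ * Nat.card H₂ * Nat.card S₃
      ≤ Nat.card D₁ * ((p + 1) * Nat.card S') * Nat.card S₃ :=
        Nat.mul_le_mul_right _ (Nat.mul_le_mul_left _ h2)
    _ = Nat.card D₁ * Nat.card S' * Nat.card S₃ * (p + 1) := by ring
    _ ≤ (p - 1) * (p + 1) := Nat.mul_le_mul_right _ h1

/-- **One-`p`-member volume law** (all `p`): TPP + `U⁺ ≤ H₁` + diagonal `D₁ ≤ H₁` + a level-`1`
identity design ⇒ `|D₁|·|H₂|·|H₃| ≤ (p-1)(p+1)²` for ARBITRARY `H₂, H₃`. -/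
theorem volume_law_onePMember {H₁ H₂ H₃ : Subgroup (GLm p 2)} (htpp : SubgroupTPP H₁ H₂ H₃)
    (hU : ∀ u : GLm p 2, (u : Mat p 2) 1 0 = 0 → (u : Mat p 2) 0 0 = 1 → (u : Mat p 2) 1 1 = 1 →
      u ∈ H₁)
    {D₁ : Subgroup (GLm p 2)} (hD₁ : D₁ ≤ H₁)
    (hd₁ : ∀ d ∈ D₁, (d : Mat p 2) 0 1 = 0 ∧ (d : Mat p 2) 1 0 = 0)
    (hdesign : ∃ f ∈ levelSubmodule p 2 1, f 1 = 1 ∧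
      ∀ a ∈ H₁, ∀ b ∈ H₂, ∀ c ∈ H₃, a * b * c ≠ 1 → f (a * b * c) = 0) :
    Nat.card D₁ * Nat.card H₂ * Nat.card H₃ ≤ (p - 1) * (p + 1) * (p + 1) := by
  obtain ⟨t, u, -, -, hbudget⟩ := conj_torus_budget htpp hU hD₁ hd₁ hdesign
  obtain ⟨S₃, h3le, h3s, h3B⟩ := exists_upper_part (H₃.map (MulAut.conj u).toMonoidHom)
  have h1 := hbudget S₃ h3le h3s
  have h3 := card_le_succ_mul_card_upper _ S₃ h3B
  rw [card_map_conj_eq] at h3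
  calc Nat.card D₁ * Nat.card H₂ * Nat.card H₃
      ≤ Nat.card D₁ * Nat.card H₂ * ((p + 1) * Nat.card S₃) := Nat.mul_le_mul_left _ h3
    _ = Nat.card D₁ * Nat.card H₂ * Nat.card S₃ * (p + 1) := by ring
    _ ≤ (p - 1) * (p + 1) * (p + 1) := Nat.mul_le_mul_right _ h1

/-- **Frame volume law, placement `(U⁺T₁, S, U⁻T₂)`** (all `p`): if in addition `H₃` has a
diagonal subgroup `D₃`, then `|D₁|·|H₂|·|D₃| ≤ (p-1)(p+1)`. -/
theorem volume_law_frame13 {H₁ H₂ H₃ : Subgroup (GLm p 2)} (htpp : SubgroupTPP H₁ H₂ H₃)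
    (hU : ∀ u : GLm p 2, (u : Mat p 2) 1 0 = 0 → (u : Mat p 2) 0 0 = 1 → (u : Mat p 2) 1 1 = 1 →
      u ∈ H₁)
    {D₁ D₃ : Subgroup (GLm p 2)} (hD₁ : D₁ ≤ H₁) (hD₃ : D₃ ≤ H₃)
    (hd₁ : ∀ d ∈ D₁, (d : Mat p 2) 0 1 = 0 ∧ (d : Mat p 2) 1 0 = 0)
    (hd₃ : ∀ d ∈ D₃, (d : Mat p 2) 0 1 = 0 ∧ (d : Mat p 2) 1 0 = 0)
    (hdesign : ∃ f ∈ levelSubmodule p 2 1, f 1 = 1 ∧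
      ∀ a ∈ H₁, ∀ b ∈ H₂, ∀ c ∈ H₃, a * b * c ≠ 1 → f (a * b * c) = 0) :
    Nat.card D₁ * Nat.card H₂ * Nat.card D₃ ≤ (p - 1) * (p + 1) := by
  obtain ⟨t, u, hu, hu', hbudget⟩ := conj_torus_budget htpp hU hD₁ hd₁ hdesign
  have hs₃ : ∀ s ∈ D₃.map (MulAut.conj u).toMonoidHom, (s : Mat p 2) 1 0 = 0 := by
    intro x hx
    have hd := hd₃ _ (mem_map_conj_iff'.mp hx)
    have h := (conj_entries_of_upper hu hu' (u⁻¹ * x * u) hd.2).1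
    rwa [show u * (u⁻¹ * x * u) * u⁻¹ = x by group] at h
  have h1 := hbudget _ (Subgroup.map_mono hD₃) hs₃
  rwa [card_map_conj_eq] at h1

/-- **No level-one witness with `U⁺ ≤ H₁` in its Borel** (all primes `p ≥ 5`, all `0 < ε ≤ 1`,
`H₂, H₃` arbitrary): a frame member `H₁` (`U⁺ ≤ H₁`, diagonal `D₁ ≤ H₁`, `|H₁| ≤ p|D₁|`) in a TPP
triple with a level-`1` identity design forces `|H₁||H₂||H₃| ≤ p(p+1)²(p-1) ≤ 1 + p³ + (p-2)(p+1)³`,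
so the crux inequality fails. -/
theorem no_levelOne_witness_onePMember (hp5 : 5 ≤ p) {ε : ℝ} (hε : 0 < ε) (hε1 : ε ≤ 1)
    {H₁ H₂ H₃ : Subgroup (GLm p 2)} (htpp : SubgroupTPP H₁ H₂ H₃)
    (hU : ∀ u : GLm p 2, (u : Mat p 2) 1 0 = 0 → (u : Mat p 2) 0 0 = 1 → (u : Mat p 2) 1 1 = 1 →
      u ∈ H₁)
    {D₁ : Subgroup (GLm p 2)} (hD₁ : D₁ ≤ H₁)
    (hd₁ : ∀ d ∈ D₁, (d : Mat p 2) 0 1 = 0 ∧ (d : Mat p 2) 1 0 = 0)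
    (hK₁ : Nat.card H₁ ≤ p * Nat.card D₁)
    (hdesign : ∃ c : Mat p 2 → ℂ, (∀ M, 1 < M.rank → c M = 0) ∧
      (∑ M, c M * ZMod.stdAddChar (Matrix.trace (M * ((1 : GLm p 2) : Mat p 2)))) = 1 ∧
      ∀ a ∈ H₁, ∀ b ∈ H₂, ∀ g ∈ H₃, a * b * g ≠ 1 →
        (∑ M, c M *
          ZMod.stdAddChar (Matrix.trace (M * ((a * b * g : GLm p 2) : Mat p 2)))) = 0) :
    ¬ budget p 2 1 (2 + ε) <
      ((Nat.card H₁ * Nat.card H₂ * Nat.card H₃ : ℕ) : ℝ) ^ ((2 + ε) / 3) := by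
  obtain ⟨c, hc, hc1, hc0⟩ := hdesign
  have h := volume_law_onePMember htpp hU hD₁ hd₁
    ⟨fourierFn c, fourierFn_mem_levelSubmodule hc, hc1, fun a ha b hb g hg hne =>
      hc0 a ha b hb g hg hne⟩
  refine no_levelOne_witness_of_volume_le_nat (by linarith) hε1 ?_
  calc Nat.card H₁ * Nat.card H₂ * Nat.card H₃
      ≤ p * Nat.card D₁ * Nat.card H₂ * Nat.card H₃ :=
        Nat.mul_le_mul_right _ (Nat.mul_le_mul_right _ hK₁)
    _ = p * (Nat.card D₁ * Nat.card H₂ * Nat.card H₃) := by ring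
    _ ≤ p * ((p - 1) * (p + 1) * (p + 1)) := Nat.mul_le_mul_left _ h
    _ = p * ((p + 1) * (p + 1)) * (p - 1) := by ring
    _ ≤ 1 + p ^ 3 + (p - 2) * (p + 1) ^ 3 := mul_succ_sq_mul_pred_le_floor hp5

/-- **No level-one witness on a `(U⁺T₁, S, U⁻T₂)`-frame** (all primes `p ≥ 3`, all `0 < ε ≤ 1`):
`U⁺ ≤ H₁`, diagonal `D₁ ≤ H₁`, `D₃ ≤ H₃` with `|H₁| ≤ p|D₁|`, `|H₃| ≤ p|D₃|`, `H₂` arbitrary,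
TPP and a level-`1` identity design force `|H₁||H₂||H₃| ≤ p²(p²-1) ≤ 1 + p³ + (p-2)(p+1)³`. -/
theorem no_levelOne_witness_of_frame13 (hp3 : 3 ≤ p) {ε : ℝ} (hε : 0 < ε) (hε1 : ε ≤ 1)
    {H₁ H₂ H₃ : Subgroup (GLm p 2)} (htpp : SubgroupTPP H₁ H₂ H₃)
    (hU : ∀ u : GLm p 2, (u : Mat p 2) 1 0 = 0 → (u : Mat p 2) 0 0 = 1 → (u : Mat p 2) 1 1 = 1 →
      u ∈ H₁)
    {D₁ D₃ : Subgroup (GLm p 2)} (hD₁ : D₁ ≤ H₁) (hD₃ : D₃ ≤ H₃)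
    (hd₁ : ∀ d ∈ D₁, (d : Mat p 2) 0 1 = 0 ∧ (d : Mat p 2) 1 0 = 0)
    (hd₃ : ∀ d ∈ D₃, (d : Mat p 2) 0 1 = 0 ∧ (d : Mat p 2) 1 0 = 0)
    (hK₁ : Nat.card H₁ ≤ p * Nat.card D₁) (hK₃ : Nat.card H₃ ≤ p * Nat.card D₃)
    (hdesign : ∃ c : Mat p 2 → ℂ, (∀ M, 1 < M.rank → c M = 0) ∧
      (∑ M, c M * ZMod.stdAddChar (Matrix.trace (M * ((1 : GLm p 2) : Mat p 2)))) = 1 ∧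
      ∀ a ∈ H₁, ∀ b ∈ H₂, ∀ g ∈ H₃, a * b * g ≠ 1 →
        (∑ M, c M *
          ZMod.stdAddChar (Matrix.trace (M * ((a * b * g : GLm p 2) : Mat p 2)))) = 0) :
    ¬ budget p 2 1 (2 + ε) <
      ((Nat.card H₁ * Nat.card H₂ * Nat.card H₃ : ℕ) : ℝ) ^ ((2 + ε) / 3) := by
  obtain ⟨c, hc, hc1, hc0⟩ := hdesign
  have h := volume_law_frame13 htpp hU hD₁ hD₃ hd₁ hd₃
    ⟨fourierFn c, fourierFn_mem_levelSubmodule hc, hc1, fun a ha b hb g hg hne =>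
      hc0 a ha b hb g hg hne⟩
  refine no_levelOne_witness_of_volume_le_nat (by linarith) hε1 ?_
  calc Nat.card H₁ * Nat.card H₂ * Nat.card H₃
      ≤ p * Nat.card D₁ * Nat.card H₂ * (p * Nat.card D₃) :=
        Nat.mul_le_mul (Nat.mul_le_mul_right _ hK₁) hK₃
    _ = p * p * (Nat.card D₁ * Nat.card H₂ * Nat.card D₃) := by ring
    _ ≤ p * p * ((p - 1) * (p + 1)) := Nat.mul_le_mul_left _ h
    _ ≤ 1 + p ^ 3 + (p - 2) * (p + 1) ^ 3 := sq_mul_pred_mul_succ_le_floor hp3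

end OnePMemberLaw

end Summit.MatrixMultiplication.MatrixMultiplication.Theorems.SubgroupIdentityDesigns.Negative

end
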